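import Literature.MathematicalPhysics.QuantumFieldTheory.Balaban1983to89.B9Cor35GpAtCubeLetters
import Literature.MathematicalPhysics.QuantumFieldTheory.Balaban1983to89.B9Cor36CubeCutoffs
import Literature.MathematicalPhysics.QuantumFieldTheory.Balaban1983to89.B9Eq359CubeKernelsAtOne

/-!
# `Balaban1983to89.B9Cor36GpCubeIsUnit` — [Balaban1985BackgroundPropagators] COROLLARY 3.6 p. 408 AT ONE COVER CUBE □, THE INVERTIBILITY OF
# `Δ′_{a,□}(Ṽ_□)` (Theorem 3.4 at the cube, `Ṽ_□ = e^{iηχ̃_□A}·1`) AND THE TWO LOCAL-INVERSE LAWS OF THE LETTER `O_□ = χ_□R(u)⁻¹G′_□(Ṽ_□)R(u)χ_□`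
# AT THE CUT-OFF OF RECORD `h_□` — p21's M5.5 FILE 6 binders `hloc`, `hlocT` DISCHARGED DOWN TO THE (3.35) CUBE DATUM, uniformly in the member and
# the cube — sub-row G-B9-LETTERS, module M5.1b-G′ (site sector), FILE 7a of seat p33's plan

statement-level skeleton of published theorems with citation tags; proofs where landed; nothing here is a claim about the Yang–Mills mass gap

CITATION HEADER (lean-in-tree rule).  B9 = T. Bałaban, *Propagators for lattice gauge theories in a background field*, Commun. Math. Phys. **99** (1985)
389–434 [Balaban1985BackgroundPropagators] (held `paper:balaban1985-cmp99-background-propagators`; journal page = PDF page + 388): Cor. 3.6 p. 408 l. 1–10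
(«U … regular on each cube □̃ from the cover π′_j … after the gauge transformation (3.35) … the operators G_□(U), G′_□(U) defined by the sequence
{Ω_n(□)} satisfy (3.42)–(3.47) for x, y, y′ ∈ □̃»); Sect. C p. 408 l. 36–44, p. 409 l. 1–5; (3.88) p. 409 («G′_□(U)Δ′(U)h_□ = h_□ because … = I on
□̃»); Thm 3.4 p. 400 («G′(U′U) = (Δ′_a(U′U))⁻¹ exists»); Cor. 3.5 p. 407; (3.35)–(3.37) p. 396; (3.58)–(3.60) p. 402.  Rows B9.Cor3.6 × B9.Thm3.4
(cells only; no row head changes).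

WHY THIS FILE (cell lit-balaban, sub-row G-B9-LETTERS, module M5.1b-G′ booked to seat p33 g96).  p21's M5.5 FILE 6
`B9Thm37GpTorusRegularFinal.eBlock_kernelFamilySInv_Gp_of_localInverse` asks per cube the two local-inverse laws `h_□·Δ′_a(U)·O_□·h_□ = h_□²`,
`h_□·O_□·Δ′_a(U)·h_□ = h_□²`.  FILE 4 (`B9Cor36CubeCutoffs.localInverse_laws_hTY_parSymY`) proved both for the letter of design (R) modulo ONE input:
`IsUnit (Δ′_{a,□}(Ṽ_□))`.  Theorem 3.4 at the cube (FILE 6 `cor35_Gp_cube`, conclusions (1)–(2)) gives the two-sided inverse of `Δp − conj b V′(Ã)` for the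
(3.37)-small `Ã = χ̃_□A`; FILE 1's (3.60) identity says `Δp − conj b V′(Ã) = conj b(η⁻²Δ′_{a,□}(Ṽ_□))` (§1); `B9Eq359CubeKernelsAtOne.isUnit_of_conj_laws`
reads the unit back; the `A`-dependent binders of the engine are FILE 4's five (3.37) readings of `χ̃_□A` and `B9Eq359CubeKernelsAtOne`'s (3.58)/(3.59)
sizes of FILE 1's kernels at `parSymY` (currency A at the base `1`, no unitarity of `Ṽ_□` used).

WHAT IS PROVED (0 `def`; 0 sorry; 0 new named facts; standard axioms):
* §1 ★`DpK_sub_conj_vPrimeConc` — `DpK − conj b (vPrimeConc (shiftY i) 1 η (chartA (χ̃_□A)) blkCubeY (kQ 1) (kF 1 Ṽ_□) (sQ 1) (sF 1 Ṽ_□) cfunK)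
  = conj b(η⁻²Δ′_{a,□}(Ṽ_□)|_ℝ)` (FILE 1's `eq360_deltaPrimeACubeY_one` through `conj b`);
* §2 ★★★`isUnit_and_localInverse_laws` — `∃ M₀ T₀ N₀ a₁ > 0` (from FILE 6; functions of `d, L, M₂`) such that for every member above the thresholds,
  every cover cube, every gauge `u`, configuration `U`, field `A`, set `Q ⊇ NearC(35S_n/8 + 1)`, constants `0 ≤ C`, `0 < ξ ≤ 5S_nη`, `1 ≤ Λ` with
  `L^{n+1}η ≤ Λξ`, `U^u = e^{iηA}` on the bonds of `Q`, `‖A‖ ≤ Cξ⁻¹`, `‖η⁻¹∂A‖ ≤ Cξ⁻²` on `Q`, and `max C (C(1+D₁θ))·Λ² ≤ min(a₁, 1/4)`: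
  `IsUnit (deltaPrimeACubeY i □ parSymY (locCfgY i □ η A))` ∧ the two local-inverse laws at `hTY i □` for
  `locLetterY i □ parSymY u (chiY i □) (locCfgY i □ η A)` against `deltaPrimeAY i parSymY U`.

PROOF.  Ours; assembly of FILES 1, 4, 6 and `B9Eq359CubeKernelsAtOne`; the (3.35) datum in the shape `exists_gauge_fld_of_reg335Cube` delivers.

HONEST SCOPE / NOT CLAIMED.  `[NormOneClass 𝔸]`; the datum, the smallness `α₁ ≤ min(a₁, 1/4)` (print: «α₁ = O(1)Mα₀ sufficiently small», p. 402) and the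
member thresholds are displayed hypotheses; `Q ⊇ NearC(4.375S_n + 1)` is inside print's `□̃⁵` (half-width `6S_n`); the (3.42) block `hE` of p21's FILE 6
for this letter is FILE 7b (not here); nothing on `d = 4`, the continuum, reflection positivity or the mass gap; NOT a node discharge; no row head changes.

RELATED IN THE TREE, NOT DUPLICATED: n06-c's `B9SectBCodedChainAn.isUnit_deltaPrimeAY_of_isAnRecY` (the member's pin, same algebra with `conj b` on both
factors); FILE 4's laws (used, not restated).
-/

noncomputable section

namespace Literature.MathematicalPhysics.QuantumFieldTheory.Balaban1983to89.B9Cor36GpCubeIsUnit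

open Literature.MathematicalPhysics.QuantumFieldTheory.Balaban1983to89
open Literature.MathematicalPhysics.QuantumFieldTheory.Balaban1983to89.B4PartitionUnity22 (thetaProf D1 D1_nonneg contDiff_thetaProf hasCompactSupport_thetaProf)
open Literature.MathematicalPhysics.QuantumFieldTheory.Balaban1983to89.B6KLevelCensusIndexV1 (KIdx kGeo)
open Literature.MathematicalPhysics.QuantumFieldTheory.Balaban1983to89.B6Cover236MultiLevelBlocks (cubes)
open Literature.MathematicalPhysics.QuantumFieldTheory.Balaban1983to89.B6GlobalChartV1 (PV boxEquiv)
open Literature.MathematicalPhysics.QuantumFieldTheory.Balaban1983to89.B9BackgroundsKLevelV1 (shiftsV1)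
open Literature.MathematicalPhysics.QuantumFieldTheory.Balaban1983to89.B9Eq39Adjoint (fluct covD covDstar)
open Literature.MathematicalPhysics.QuantumFieldTheory.Balaban1983to89.B9Eq352DivFormLetters (conj conj_sub)
open Literature.MathematicalPhysics.QuantumFieldTheory.Balaban1983to89.B9Eq360VprimeLetters (vPrimeConc)
open Literature.MathematicalPhysics.QuantumFieldTheory.Balaban1983to89.B9Eq360DeltaPrimeAY (mulY AfldY chartA)
open Literature.MathematicalPhysics.QuantumFieldTheory.Balaban1983to89.B9Eq360DeltaPrimeACubeY (blkCubeY kQCubeY sQCubeY cCubeY kFCubeY sFCubeY levCubeY_eq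
  eq360_deltaPrimeACubeY_one)
open Literature.MathematicalPhysics.QuantumFieldTheory.Balaban1983to89.B9CubeLettersOpsL0 (cubeFamY levCubeY deltaPrimeACubeY)
open Literature.MathematicalPhysics.QuantumFieldTheory.Balaban1983to89.B9CubeLettersBondOpsL0 (BlkCubeY)
open Literature.MathematicalPhysics.QuantumFieldTheory.Balaban1983to89.B9CubeGeometryInputs (geoCK geoCK_eta geoCK_eta_pos geoCK_len_blkCubeY RM1)
open Literature.MathematicalPhysics.QuantumFieldTheory.Balaban1983to89.B9Cor35GpCubeInputsAtOne (DpK GpK wK cfunK eta_ne_zero)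
open Literature.MathematicalPhysics.QuantumFieldTheory.Balaban1983to89.B9Cor35GpAtCubeLetters (cor35_Gp_cube)
open Literature.MathematicalPhysics.QuantumFieldTheory.Balaban1983to89.B9Cor36CutoffField337 (cutFldY)
open Literature.MathematicalPhysics.QuantumFieldTheory.Balaban1983to89.B9Cor36CubeCutoffs (SC NearC chiY chiTY locCfgY readings337_locFld
  scaleLen_levCubeY_bounds one_le_SC)
open Literature.MathematicalPhysics.QuantumFieldTheory.Balaban1983to89.B9Eq359CubeKernelsAtOne (Cq Cq_nonneg norm_kFCubeY_parSymY_le norm_sFCubeY_parSymY_le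
  ownLevel_of_blockwise isUnit_of_conj_laws)
open Literature.MathematicalPhysics.QuantumFieldTheory.Balaban1983to89.Node00 (SiteY CfgY GaugeY SiteParY toKT shiftY gaugeY parSymY parSymY_one UboxY)
open Literature.MathematicalPhysics.QuantumFieldTheory.Balaban1983to89.B9Thm37CubeCoverCommutators (cutMulY hTY)

variable {d ℓ : ℕ} {hd : 1 ≤ d + 1} {hL : Odd (ℓ + 1) ∧ 1 < ℓ + 1} {b₀ b₁ : ℝ}

variable {𝔸 : Type} [NormedRing 𝔸] [NormedAlgebra ℂ 𝔸] [CompleteSpace 𝔸]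
variable {ι : Type} [Fintype ι] (b : Module.Basis ι ℝ 𝔸)

/-! ## §1  Theorem 3.4's inverse identity read back at the cube letter: `Δp − conj b V′(Ã) = conj b(η⁻²Δ′_{a,□}(Ṽ_□))` -/

section Identity

variable (i : KIdx d ℓ hd hL b₀ b₁) (c : ↥(cubes (toKT i).D.toDomains))

/-- ★ **(3.60) AT THE CUBE IN THEOREM 3.4's LETTERS** (FILE 1's `eq360_deltaPrimeACubeY_one` conjugated by the coordinates): with `Ṽ_□ = e^{iηÃ}·1`,
`Ã = χ̃_□A`, the engine's `Δp − conj b V′(chartA Ã)` (FILE 1 kernels `kF = kQ(Ṽ) − kQ(1)`, `sF = sQ(Ṽ) − sQ(1)`, weight `cfun = η⁻²c_□`) IS `conj b(η⁻²Δ′_{a,□}(Ṽ_□))`.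
[cite: Balaban1985BackgroundPropagators, (3.60) p.402, (3.24) p.394, Cor. 3.5 p.407, p.409 l.1–5] -/
theorem DpK_sub_conj_vPrimeConc (par : SiteParY 𝔸 i) (A : AfldY 𝔸 i) :
    DpK b i c par - conj b (vPrimeConc (shiftY i) (fun _ _ => (1 : 𝔸ˣ)) (geoCK i c).eta (chartA i (cutFldY i (chiTY i c) A)) (blkCubeY i c)
        (kQCubeY i c par (fun _ _ => 1)) (kFCubeY i c par (fun _ _ => 1) (locCfgY i c (kGeo i).eta A)) (sQCubeY i c par (fun _ _ => 1))
        (sFCubeY i c par (fun _ _ => 1) (locCfgY i c (kGeo i).eta A)) (cfunK i c)) =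
      conj b ((((kGeo i).eta ^ 2)⁻¹) • (deltaPrimeACubeY i c par (locCfgY i c (kGeo i).eta A)).restrictScalars ℝ) := by
  have hη := eta_ne_zero i
  have hU : UboxY i (fun _ _ => (1 : 𝔸ˣ)) = fun _ _ => 1 := B9Cor36CutoffField337.UboxY_one i
  have hc : ((kGeo i).eta ^ 2)⁻¹ • cCubeY i c = cfunK i c := by funext s; rfl
  rw [DpK, ← conj_sub, locCfgY, eq360_deltaPrimeACubeY_one i c par hη (cutFldY i (chiTY i c) A), hU, hc, geoCK_eta]

end Identity

/-! ## §2  ★★★ `Δ′_{a,□}(Ṽ_□)` IS A UNIT and the two local-inverse laws, from the (3.35) cube datum -/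

section Main

/-- ★★★ **COROLLARY 3.6 AT ONE COVER CUBE, THE INVERTIBILITY AND THE LOCAL-INVERSE LAWS** — uniformly in the member and the cube: there are thresholds
`M₀, T₀, N₀` and Theorem 3.4's `a₁ > 0` (functions of `d, L`, the basis datum `M₂`) such that for every member above the thresholds, every cover cube `□`
and every (3.35) cube datum — a bi-contractive gauge `u` and a field `A` with `U^u = e^{iηA}` on the bonds of a torus set `Q ⊇ {within 4.375S_n + 1 of the
centre}`, `‖A‖ ≤ Cξ⁻¹`, `‖η⁻¹∂A‖ ≤ Cξ⁻²` on `Q` (`exists_gauge_fld_of_reg335Cube`), a datum scale `ξ ≤ 5S_nη` with `L^{n+1}η ≤ Λξ` — whose (3.37) size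
`α₁ := max C (C(1+D₁θ))·Λ²` is `≤ a₁` and `≤ 1/4`: the cube operator `Δ′_{a,□}(Ṽ_□)` at `Ṽ_□ = e^{iηχ̃_□A}·1` IS A UNIT (Thm 3.4 via FILE 6), and hence the
letter `O_□ = χ_□R(u)⁻¹G′_□(Ṽ_□)R(u)χ_□` satisfies BOTH local-inverse laws at `h_□` against the member's `Δ′_a(U)` at `parSymY` (FILE 4) — p21's FILE 6 binders
`hloc`, `hlocT` for this cube, discharged down to the (3.35) datum. [cite: Balaban1985BackgroundPropagators, Cor. 3.6 p.408, Cor. 3.5 p.407, Thm 3.4 p.400, (3.88) p.409, (3.35)–(3.37) p.396, p.409 l.1–5] -/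
theorem isUnit_and_localInverse_laws [NormOneClass 𝔸] [DecidableEq ι] (d ℓ : ℕ) (hℓ : 1 ≤ ℓ) (M₂ : ℝ) (hM₂ : 0 ≤ M₂) (hrepr : ∀ (v : 𝔸) (j : ι), |b.repr v j| ≤ M₂ * ‖v‖) :
    ∃ M₀ T₀ : ℝ, ∃ N₀ : ℕ, ∃ a₁ : ℝ, 0 < a₁ ∧
    ∀ {hd : 1 ≤ d + 1} {hL : Odd (ℓ + 1) ∧ 1 < ℓ + 1} {b₀ b₁ : ℝ} (i : KIdx d ℓ hd hL b₀ b₁) (c : ↥(cubes (toKT i).D.toDomains)),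
      M₀ ≤ ((ℓ : ℝ) + 1) * (toKT i).Mh → N₀ + 1 ≤ (toKT i).R * ((ℓ + 1) * (toKT i).Mh) → T₀ ≤ RM1 i →
    ∀ (g : GaugeY 𝔸 i) (U : CfgY 𝔸 i) (A : AfldY 𝔸 i) (Q : Set (Site (PV d ℓ i.m i.K hd hL) 0)) (C ξ Λ : ℝ),
      0 ≤ C → 0 < ξ → 1 ≤ Λ → ξ ≤ 5 * (SC i c : ℝ) * (kGeo i).eta → LatticeNorms.scaleLen ((ℓ : ℝ) + 1) (kGeo i).eta (c.1.1 + 1) ≤ Λ * ξ →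
      (∀ x : Site (PV d ℓ i.m i.K hd hL) 0, NearC i c (35 * SC i c / 8 + 1) (boxEquiv i.hN x).1 → x ∈ Q) →
      (∀ (κ : Fin (d + 1)) (x : Site (PV d ℓ i.m i.K hd hL) 0), x ∈ Q → x.shift κ ∈ Q → gaugeY i g U κ x = fluct (kGeo i).eta A κ x) →
      (∀ κ, ∀ x ∈ Q, ‖A κ x‖ ≤ C * ξ⁻¹) →
      (∀ μ ν, ∀ x ∈ Q, ‖(((kGeo i).eta : ℂ)⁻¹) • covD (shiftsV1 (PV d ℓ i.m i.K hd hL)) (fun _ _ => (1 : 𝔸ˣ)) μ (A ν) x‖ ≤ C * (ξ ^ 2)⁻¹) →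
      max C (C * (1 + D1 thetaProf)) * Λ ^ 2 ≤ a₁ → max C (C * (1 + D1 thetaProf)) * Λ ^ 2 ≤ 1 / 4 →
      IsUnit (deltaPrimeACubeY i c (parSymY i) (locCfgY i c (kGeo i).eta A)) ∧
      (cutMulY (hTY i c) * Node00.deltaPrimeAY i (parSymY i) U *
          B9Cor36GpCubeLocLetter.locLetterY i c (parSymY i) g (chiY i c) (locCfgY i c (kGeo i).eta A) *
          cutMulY (hTY i c) =
        cutMulY (hTY i c) *
          cutMulY (hTY i c)) ∧
      (cutMulY (hTY i c) *
          B9Cor36GpCubeLocLetter.locLetterY i c (parSymY i) g (chiY i c) (locCfgY i c (kGeo i).eta A) * Node00.deltaPrimeAY i (parSymY i) U *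
          cutMulY (hTY i c) =
        cutMulY (hTY i c) *
          cutMulY (hTY i c)) := by
  have h1A : ‖(1 : 𝔸)‖ ≤ 1 := norm_one.le
  obtain ⟨δ₀, BG, M₀, T₀, N₀, hδ₀, hBG, a₁, ha₁, B, hB, H⟩ := cor35_Gp_cube b d ℓ hℓ (Cq d) M₂ (Cq_nonneg d) hM₂ hrepr h1A
  refine ⟨M₀, T₀, N₀, a₁, ha₁, ?_⟩
  intro hd hL b₀ b₁ i c hM hN hT g U A Q C ξ Λ hC hξ hΛ hξS hΛξ hQ hgA hA hdA hα₁ hα4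
  set η : ℝ := (kGeo i).eta with hηdef
  have hη : 0 < η := by rw [hηdef, ← geoCK_eta i c]; exact geoCK_eta_pos i c
  set α₁ : ℝ := max C (C * (1 + D1 thetaProf)) * Λ ^ 2 with hα₁def
  have hα₁0 : 0 ≤ α₁ := by
    rw [hα₁def]; exact mul_nonneg (le_max_of_le_left hC) (sq_nonneg _)
  -- the length function of the engine at the cube blocks is `L^{n(z)}η`
  have hL1 : (1 : ℝ) ≤ (ℓ : ℝ) + 1 := by linarith [(Nat.cast_nonneg ℓ : (0 : ℝ) ≤ ℓ)]
  have hlenS : ∀ z : SiteY i, (geoCK i c).len (blkCubeY i c z) = LatticeNorms.scaleLen ((ℓ : ℝ) + 1) η (levCubeY i c z) := fun z => by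
    rw [(geoCK_len_blkCubeY i c z).1]; rfl
  have hlen : ∀ z : SiteY i, 0 < (geoCK i c).len (blkCubeY i c z) := fun z => by
    rw [hlenS]; exact (scaleLen_levCubeY_bounds i c hL1 hη hΛξ z).1
  have hlenΛ : ∀ z : SiteY i, (geoCK i c).len (blkCubeY i c z) ≤ Λ * ξ := fun z => by
    rw [hlenS]; exact (scaleLen_levCubeY_bounds i c hL1 hη hΛξ z).2
  -- the five (3.37) readings of the cut field (FILE 4)
  obtain ⟨r1, r2, r3, r4, r5⟩ := readings337_locFld i c hC hη hξ hΛ hξS hQ hA hdA (fun z => (geoCK i c).len (blkCubeY i c z)) hlen hlenΛ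
  -- the (3.59) kernel sizes (FILE 7a-prep, currency A at the base `1`, `G := ⊥`)
  have hG1 : ∀ u : 𝔸ˣ, u ∈ (⊥ : Subgroup 𝔸ˣ) → ‖(u : 𝔸)‖ ≤ 1 := fun u hu => by
    rw [Subgroup.mem_bot] at hu; rw [hu, Units.val_one]; exact h1A
  have hU1 : ∀ (μ : Fin (d + 1)) (x : Site (PV d ℓ i.m i.K hd hL) 0), ((fun _ _ => (1 : 𝔸ˣ)) : CfgY 𝔸 i) μ x ∈ (⊥ : Subgroup 𝔸ˣ) :=
    fun _ _ => Subgroup.one_mem _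
  have hown := ownLevel_of_blockwise i c hη (cutFldY i (chiTY i c) A) (α₁ := α₁) (fun k x => by
    have h := r4 k x
    rw [(geoCK_len_blkCubeY i c x).1, levCubeY_eq] at h
    push_cast
    exact h)
  have hkF : ∀ (y : BlkCubeY i c) (x : SiteY i), blkCubeY i c x = y →
      ‖kFCubeY i c (parSymY i) (fun _ _ => 1) (locCfgY i c η A) y x‖ ≤ Cq d * α₁ * wK i c y :=
    fun y x hx => norm_kFCubeY_parSymY_le i c ⊥ hG1 hU1 hη.le (cutFldY i (chiTY i c) A) y hα₁0 hα4 (hown y) x hx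
  have hsF : ∀ x : SiteY i, ‖sFCubeY i c (parSymY i) (fun _ _ => 1) (locCfgY i c η A) x‖ ≤ Cq d * α₁ :=
    fun x => norm_sFCubeY_parSymY_le i c ⊥ hG1 hU1 hη.le (cutFldY i (chiTY i c) A) x hα₁0 hα4 (hown (blkCubeY i c x))
  -- Theorem 3.4 at the cube (FILE 6): the two-sided inverse
  have hparone : ∀ z w : SiteY i, parSymY i (fun _ _ => (1 : 𝔸ˣ)) z w = 1 := fun z w => parSymY_one i z w
  obtain ⟨l1, l2, -, -⟩ := H i c 0 True (parSymY i) hparone hM hN hT α₁ hα₁0 hα₁ (chartA i (cutFldY i (chiTY i c) A))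
    (kFCubeY i c (parSymY i) (fun _ _ => 1) (locCfgY i c η A)) (sFCubeY i c (parSymY i) (fun _ _ => 1) (locCfgY i c η A)) hkF hsF
    (fun ν k x => by rw [geoCK_eta]; exact r1 ν k x) (fun μ ν x => by rw [geoCK_eta]; exact r2 μ ν x)
    (fun μ x => by rw [geoCK_eta]; exact r3 μ x) r4 r5
  rw [DpK_sub_conj_vPrimeConc] at l1 l2
  have hunit : IsUnit (deltaPrimeACubeY i c (parSymY i) (locCfgY i c η A)) :=
    isUnit_of_conj_laws b _ (inv_ne_zero (pow_ne_zero 2 (eta_ne_zero i))) _ l1 l2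
  have hQ' : ∀ x : Site (PV d ℓ i.m i.K hd hL) 0, NearC i c (3 * SC i c + 2) (boxEquiv i.hN x).1 → x ∈ Q := fun x hx =>
    hQ x (hx.mono i c (by have := one_le_SC i c; omega))
  exact ⟨hunit, B9Cor36CubeCutoffs.localInverse_laws_hTY_parSymY i c g U η A hQ' hgA hunit⟩

end Main

end Literature.MathematicalPhysics.QuantumFieldTheory.Balaban1983to89.B9Cor36GpCubeIsUnit

end
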